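import Summits.QuantumFields.BalabanUV.T4Continuum.Support.NE7TraceLinkSecondVariation
import Summits.QuantumFields.BalabanUV.T4Continuum.Support.NE7BoxPoincareMatrix
import HarnessLib

/-!
# NE7 — THE HESSIAN OF THE FREE-BOUNDARY TRACE LINK FUNCTIONAL ON A BOX IS BOUNDED BELOW BY THE DIRICHLET FORM OF THE DIRECTION, UP TO A
# SMALL-FIELD FACTOR AND AN EULER–LAGRANGE TERM: `H ≥ (1 − n·w − n·d·M·w_a)·D(η) − ‖η̄‖·Σ_x ‖η x‖·‖E x‖` (F311b)

Cell `pub-balaban`, rung (B)+1 sub-cell t4, lineage `b2b-balaban-t4-ne7-p1` (CRUX PROVER NE7 #1 = OWNER of row NE7), generation 93; memo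
`t4/b2b-balaban-t4-ne7-p1-g93/UHLENBECK-ROAD.md` §3.  Over F310 `NE7TraceLinkSecondVariation` (bondwise identity of the second variation) and F311a
`NE7BoxPoincareMatrix.poincare_periodBox_nhs` (box Poincaré for matrix fields).

THE ESTIMATE.  On the box `periodBox M` (`M = m+1`) with links `L(x,κ)` (the gauged configuration), a direction `η` (skew on the box), bond
differences `δ_b = η(x+e_κ) − η(x)`, Dirichlet form `D = Σ_b ‖δ_b‖²_{HS}∕n`, small-field letters `‖L_b − 1‖ ≤ w`, `‖L_b − L_bᴴ‖ ≤ w_a`, box mean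
`η̄`, and the free-boundary Euler–Lagrange expression `E(x) = Σ_κ [𝟙(x+e_κ ∈ box)(L − Lᴴ)(x,κ) − 𝟙(x−e_κ ∈ box)(L − Lᴴ)(x−e_κ,κ)]`:
the bond sum `H` of the second variations `−Re tr(η_x(η_xL_b − L_bη_{x'}) − (η_xL_b − L_bη_{x'})η_{x'})∕n` satisfies
`H ≥ (1 − n·w − n·d·M·w_a)·D − ‖η̄‖·Σ_x ‖η(x)‖·‖E(x)‖`.
PROOF.  F310: `H = D − Σ_b Re tr((L_b − 1)δ_b²)∕n − ½Σ_b Re tr(X_b[η_x, δ_b])∕n`, `X_b = L_b − L_bᴴ`.  Split `η_x = η̄ + η₀(x)`: the `η₀` part is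
`≤ w_a Σ_b ‖η₀(x)‖‖δ_b‖ ≤ w_a·n·d·M·D` (AM–GM with weight `1/M` and the box Poincaré inequality, constant `m(m+1)/2`); the `η̄` part RESUMS BY SITES
(`Σ_b (δ_bX_b − X_bδ_b) = −Σ_x [η_x, E(x)]`, discrete integration by parts on the box graph) into `½Σ_x Re tr([η_x, E(x)]·η̄)∕n`, bounded by
`‖η̄‖Σ_x‖η_x‖‖E(x)‖`.  At an exact Landau gauge `E = 0` and the Hessian is coercive on mean-zero directions as soon as `n·w + n·d·M·w_a < 1` —
`M²ε ≪ 1` in the NE7 chart; near a Landau gauge the `E`-term is as small as the Euler–Lagrange defect (road U-IM, F312).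

WHAT ([folklore]; 0 def, 0 sorry): `sum_shift_indicator` (shift reindexing on the box), **`sum_bond_comm_resum`** (integration by parts of the
commutator pairing), `norm_sq_le_card_mul_nhsNormSq`, and **`hessian_lower`**.
HONEST FRAMING (page 1): elementary lattice∕matrix analysis; nothing of Bałaban's asserted; NE7 NOT PROVED here; spine 0∕9; finite T⁴ rung (B)+1 — NOT
infinite volume, NOT mass gap, NOT `BetaPertH`, NOT Clay.  No `sorry`; axioms ⊆ {propext, Classical.choice, Quot.sound}.
-/

set_option autoImplicit false

open scoped BigOperators Matrix Matrix.Norms.L2Operator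
open Finset NormedSpace

namespace Summit.QuantumFields.BalabanUV.T4Continuum.NE7TraceLinkHessianLower

open Literature.MathematicalPhysics.QuantumFieldTheory.Balaban1983to89
open B7Prop1Explicit UnitaryModel MatrixNorms
open T4AveragingDeficitWallBoundary (periodBox mem_periodBox)
open NE3HessBounds (nReTr_mul_comm nReTr_neg' neg_nReTr_mul_self_of_skew opNorm_sq_div_card_le_nhsNormSq)
open AveragingDeficitNearIdentity (abs_nReTr_mul_le)
open T4TiltOscillation (nReTr_add nReTr_sub)
open NE7TraceLinkSecondVariation (nReTr_secondVar_eq nReTr_mul_skew_eq_half conjTranspose_comm_skew)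
open NE7BoxPoincareMatrix (poincare_periodBox_nhs)

noncomputable section

variable {d : ℕ} {n : Type*} [Fintype n] [DecidableEq n]

/-! ## §1 Integration by parts of the commutator pairing on the box -/

omit [Fintype n] [DecidableEq n] in
/-- Shift reindexing on the box: `Σ_{x ∈ box} 𝟙(x + e_κ ∈ box) g(x + e_κ) = Σ_{z ∈ box} 𝟙(z − e_κ ∈ box) g z`. [folklore] -/
theorem sum_shift_indicator {E : Type*} [AddCommMonoid E] (M : ℕ) (κ : Fin d) (g : Site d → E) :
    ∑ x ∈ periodBox (d := d) M, (if x + e κ ∈ periodBox (d := d) M then g (x + e κ) else 0)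
      = ∑ z ∈ periodBox (d := d) M, (if z - e κ ∈ periodBox (d := d) M then g z else 0) := by
  rw [← Finset.sum_filter, ← Finset.sum_filter]
  refine Finset.sum_nbij' (fun x => x + e κ) (fun z => z - e κ) ?_ ?_ ?_ ?_ ?_
  · intro x hx
    rw [Finset.mem_filter] at hx ⊢
    exact ⟨hx.2, by rw [add_sub_cancel_right]; exact hx.1⟩
  · intro z hz
    rw [Finset.mem_filter] at hz ⊢
    exact ⟨hz.2, by rw [sub_add_cancel]; exact hz.1⟩
  · intro x _; exact add_sub_cancel_right x (e κ)
  · intro z _; exact sub_add_cancel z (e κ)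
  · intro x _; rfl

omit [DecidableEq n] in
/-- **INTEGRATION BY PARTS OF THE COMMUTATOR PAIRING ON THE BOX GRAPH**: with `X` a bond field and `η` a site field,
`Σ_{x ∈ box} Σ_κ 𝟙(x+e_κ ∈ box)·[(η(x+e_κ)X(x,κ) − X(x,κ)η(x+e_κ)) − (η(x)X(x,κ) − X(x,κ)η(x))] = Σ_{x ∈ box} (η(x)F(x) − F(x)η(x))`,
`F(x) = Σ_κ [𝟙(x−e_κ ∈ box) X(x−e_κ,κ) − 𝟙(x+e_κ ∈ box) X(x,κ)]` (incoming minus outgoing bonds). [folklore] -/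
theorem sum_bond_comm_resum (M : ℕ) (η : Site d → Matrix n n ℂ) (X : Site d → Fin d → Matrix n n ℂ) :
    ∑ x ∈ periodBox (d := d) M, ∑ κ : Fin d, (if x + e κ ∈ periodBox (d := d) M then
        ((η (x + e κ) * X x κ - X x κ * η (x + e κ)) - (η x * X x κ - X x κ * η x)) else 0)
      = ∑ x ∈ periodBox (d := d) M, (η x * (∑ κ : Fin d, ((if x - e κ ∈ periodBox (d := d) M then X (x - e κ) κ else 0)
            - (if x + e κ ∈ periodBox (d := d) M then X x κ else 0)))
          - (∑ κ : Fin d, ((if x - e κ ∈ periodBox (d := d) M then X (x - e κ) κ else 0)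
            - (if x + e κ ∈ periodBox (d := d) M then X x κ else 0))) * η x) := by
  -- split the bond sum into its tip part and its base part
  have hsplit : ∀ (x : Site d) (κ : Fin d), (if x + e κ ∈ periodBox (d := d) M then
        ((η (x + e κ) * X x κ - X x κ * η (x + e κ)) - (η x * X x κ - X x κ * η x)) else 0)
      = (if x + e κ ∈ periodBox (d := d) M then (η (x + e κ) * X x κ - X x κ * η (x + e κ)) else 0)
        - (if x + e κ ∈ periodBox (d := d) M then (η x * X x κ - X x κ * η x) else 0) := by
    intro x κ; split_ifs <;> simp
  have hL : ∑ x ∈ periodBox (d := d) M, ∑ κ : Fin d, (if x + e κ ∈ periodBox (d := d) M then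
        ((η (x + e κ) * X x κ - X x κ * η (x + e κ)) - (η x * X x κ - X x κ * η x)) else 0)
      = ∑ x ∈ periodBox (d := d) M, ∑ κ : Fin d, (if x + e κ ∈ periodBox (d := d) M then
          (η (x + e κ) * X x κ - X x κ * η (x + e κ)) else 0)
        - ∑ x ∈ periodBox (d := d) M, ∑ κ : Fin d, (if x + e κ ∈ periodBox (d := d) M then (η x * X x κ - X x κ * η x) else 0) := by
    simp only [hsplit, Finset.sum_sub_distrib]
  rw [hL]
  -- reindex the tip part
  have htip : ∀ κ : Fin d, ∑ x ∈ periodBox (d := d) M, (if x + e κ ∈ periodBox (d := d) M then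
        (η (x + e κ) * X x κ - X x κ * η (x + e κ)) else 0)
      = ∑ z ∈ periodBox (d := d) M, (if z - e κ ∈ periodBox (d := d) M then (η z * X (z - e κ) κ - X (z - e κ) κ * η z) else 0) := by
    intro κ
    have h := sum_shift_indicator M κ (fun z => η z * X (z - e κ) κ - X (z - e κ) κ * η z)
    simp only [add_sub_cancel_right] at h
    exact h
  have h1 : ∑ x ∈ periodBox (d := d) M, ∑ κ : Fin d, (if x + e κ ∈ periodBox (d := d) M then
        (η (x + e κ) * X x κ - X x κ * η (x + e κ)) else 0)
      = ∑ x ∈ periodBox (d := d) M, ∑ κ : Fin d,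
          (if x - e κ ∈ periodBox (d := d) M then (η x * X (x - e κ) κ - X (x - e κ) κ * η x) else 0) := by
    rw [Finset.sum_comm]
    exact (Finset.sum_congr rfl fun κ _ => htip κ).trans Finset.sum_comm
  rw [h1, ← Finset.sum_sub_distrib
    (fun x => ∑ κ : Fin d, (if x - e κ ∈ periodBox (d := d) M then (η x * X (x - e κ) κ - X (x - e κ) κ * η x) else 0))
    (fun x => ∑ κ : Fin d, (if x + e κ ∈ periodBox (d := d) M then (η x * X x κ - X x κ * η x) else 0))]
  apply Finset.sum_congr rfl
  intro x _
  rw [Finset.mul_sum, Finset.sum_mul, ← Finset.sum_sub_distrib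
    (fun κ => (if x - e κ ∈ periodBox (d := d) M then (η x * X (x - e κ) κ - X (x - e κ) κ * η x) else 0))
    (fun κ => (if x + e κ ∈ periodBox (d := d) M then (η x * X x κ - X x κ * η x) else 0)),
    ← Finset.sum_sub_distrib
    (fun κ => η x * ((if x - e κ ∈ periodBox (d := d) M then X (x - e κ) κ else 0)
      - (if x + e κ ∈ periodBox (d := d) M then X x κ else 0)))
    (fun κ => ((if x - e κ ∈ periodBox (d := d) M then X (x - e κ) κ else 0)
      - (if x + e κ ∈ periodBox (d := d) M then X x κ else 0)) * η x)]
  refine Finset.sum_congr rfl fun κ _ => ?_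
  split_ifs <;> simp [mul_sub, sub_mul] <;> abel

/-! ## §2 The Hessian lower bound -/

/-- `‖K‖² ≤ n · nhsNormSq K` (operator norm against the normalised Hilbert–Schmidt square). [folklore] -/
theorem norm_sq_le_card_mul_nhsNormSq [Nonempty n] (K : Matrix n n ℂ) : ‖K‖ ^ 2 ≤ (Fintype.card n : ℝ) * nhsNormSq K := by
  have hN : (0 : ℝ) < Fintype.card n := Nat.cast_pos.mpr Fintype.card_pos
  have h := opNorm_sq_div_card_le_nhsNormSq K
  rwa [div_le_iff₀ hN, mul_comm] at h

set_option maxHeartbeats 1600000 in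
/-- **THE HESSIAN LOWER BOUND** (`d ≥ 1`, box `periodBox (m+1) ⊂ ℤᵈ`).  For a site field `η`, skew on the box, links `L(x,κ)` with
`‖L(x,κ) − 1‖ ≤ w` and `‖L(x,κ) − L(x,κ)ᴴ‖ ≤ w_a` on the box bonds (`w, w_a ≥ 0`): the bond sum of the second variations (F310) is at least
`(1 − n·w − n·d·(m+1)·w_a)·D − ‖η̄‖·Σ_{x ∈ box} ‖η x‖·‖E x‖`, with `D` the HS Dirichlet form of `η` on the box bonds, `η̄` the box mean of `η` and
`E` the free-boundary Euler–Lagrange expression of `L`. [folklore] -/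
theorem hessian_lower [Nonempty n] (hd : 1 ≤ d) (m : ℕ) (η : Site d → Matrix n n ℂ)
    (hη : ∀ x ∈ periodBox (d := d) (m + 1), η x ∈ skewAdjoint (Matrix n n ℂ)) (L : Site d → Fin d → Matrix n n ℂ) {w wa : ℝ}
    (hw0 : 0 ≤ w) (hwa0 : 0 ≤ wa)
    (hw : ∀ (x : Site d) (κ : Fin d), x ∈ periodBox (d := d) (m + 1) → x + e κ ∈ periodBox (d := d) (m + 1) → ‖L x κ - 1‖ ≤ w)
    (hwa : ∀ (x : Site d) (κ : Fin d), x ∈ periodBox (d := d) (m + 1) → x + e κ ∈ periodBox (d := d) (m + 1) → ‖L x κ - (L x κ)ᴴ‖ ≤ wa) :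
    (1 - (Fintype.card n : ℝ) * w - (Fintype.card n : ℝ) * d * (m + 1) * wa)
        * ∑ x ∈ periodBox (d := d) (m + 1), ∑ κ : Fin d,
            (if x + e κ ∈ periodBox (d := d) (m + 1) then nhsNormSq (η (x + e κ) - η x) else 0)
      - ‖(((m + 1 : ℕ) : ℂ) ^ d)⁻¹ • ∑ z ∈ periodBox (d := d) (m + 1), η z‖
        * ∑ x ∈ periodBox (d := d) (m + 1), ‖η x‖ * ‖∑ κ : Fin d,
            ((if x + e κ ∈ periodBox (d := d) (m + 1) then (L x κ - (L x κ)ᴴ) else 0)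
              - (if x - e κ ∈ periodBox (d := d) (m + 1) then (L (x - e κ) κ - (L (x - e κ) κ)ᴴ) else 0))‖
      ≤ ∑ x ∈ periodBox (d := d) (m + 1), ∑ κ : Fin d, (if x + e κ ∈ periodBox (d := d) (m + 1) then
          -nReTr (η x * (η x * L x κ - L x κ * η (x + e κ)) - (η x * L x κ - L x κ * η (x + e κ)) * η (x + e κ)) else 0) := by
  -- abbreviations
  set pB := periodBox (d := d) (m + 1) with hpB
  set N : ℝ := (Fintype.card n : ℝ) with hN
  have hN0 : 0 < N := Nat.cast_pos.mpr Fintype.card_pos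
  set mbar : Matrix n n ℂ := (((m + 1 : ℕ) : ℂ) ^ d)⁻¹ • ∑ z ∈ pB, η z with hmbar
  set η₀ : Site d → Matrix n n ℂ := fun x => η x - mbar with hη₀
  set X : Site d → Fin d → Matrix n n ℂ := fun x κ => L x κ - (L x κ)ᴴ with hX
  set D : ℝ := ∑ x ∈ pB, ∑ κ : Fin d, (if x + e κ ∈ pB then nhsNormSq (η (x + e κ) - η x) else 0) with hD
  set E : Site d → Matrix n n ℂ := fun x => ∑ κ : Fin d, ((if x + e κ ∈ pB then X x κ else 0)
    - (if x - e κ ∈ pB then X (x - e κ) κ else 0)) with hE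
  have hD0 : 0 ≤ D := Finset.sum_nonneg fun x _ => Finset.sum_nonneg fun κ _ => by
    split_ifs
    · exact MatrixNorms.nhsNormSq_nonneg _
    · exact le_rfl
  -- §a the bondwise identity (F310)
  have hbond : ∀ (x : Site d) (κ : Fin d), x ∈ pB → x + e κ ∈ pB →
      -nReTr (η x * (η x * L x κ - L x κ * η (x + e κ)) - (η x * L x κ - L x κ * η (x + e κ)) * η (x + e κ))
        = nhsNormSq (η (x + e κ) - η x) - nReTr ((L x κ - 1) * ((η (x + e κ) - η x) * (η (x + e κ) - η x)))
          - (1 / 2) * nReTr (X x κ * (η₀ x * (η (x + e κ) - η x) - (η (x + e κ) - η x) * η₀ x))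
          - (1 / 2) * nReTr (X x κ * (mbar * (η (x + e κ) - η x) - (η (x + e κ) - η x) * mbar)) := by
    intro x κ hx hxκ
    have ha := hη x hx
    have hc := hη (x + e κ) hxκ
    have hδ : η (x + e κ) - η x ∈ skewAdjoint (Matrix n n ℂ) := (skewAdjoint _).sub_mem hc ha
    rw [nReTr_secondVar_eq]
    have h1 : nReTr (L x κ * ((η (x + e κ) - η x) * (η (x + e κ) - η x)))
        = nReTr ((η (x + e κ) - η x) * (η (x + e κ) - η x)) + nReTr ((L x κ - 1) * ((η (x + e κ) - η x) * (η (x + e κ) - η x))) := by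
      rw [← nReTr_add]; congr 1; noncomm_ring
    have h2 : -nReTr ((η (x + e κ) - η x) * (η (x + e κ) - η x)) = nhsNormSq (η (x + e κ) - η x) := neg_nReTr_mul_self_of_skew hδ
    have h3 : nReTr (L x κ * (η x * (η (x + e κ) - η x) - (η (x + e κ) - η x) * η x))
        = (1 / 2) * nReTr (X x κ * (η x * (η (x + e κ) - η x) - (η (x + e κ) - η x) * η x)) :=
      nReTr_mul_skew_eq_half _ _ (conjTranspose_comm_skew ha hδ)
    have h4 : X x κ * (η x * (η (x + e κ) - η x) - (η (x + e κ) - η x) * η x)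
        = X x κ * (η₀ x * (η (x + e κ) - η x) - (η (x + e κ) - η x) * η₀ x)
          + X x κ * (mbar * (η (x + e κ) - η x) - (η (x + e κ) - η x) * mbar) := by
      simp only [hη₀]; noncomm_ring
    rw [h1, h3, h4, nReTr_add]
    linarith
  -- §b the bond sum of the identity
  have hsum : ∑ x ∈ pB, ∑ κ : Fin d, (if x + e κ ∈ pB then
        -nReTr (η x * (η x * L x κ - L x κ * η (x + e κ)) - (η x * L x κ - L x κ * η (x + e κ)) * η (x + e κ)) else 0)
      = D - ∑ x ∈ pB, ∑ κ : Fin d, (if x + e κ ∈ pB then nReTr ((L x κ - 1) * ((η (x + e κ) - η x) * (η (x + e κ) - η x))) else 0)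
        - (1 / 2) * ∑ x ∈ pB, ∑ κ : Fin d, (if x + e κ ∈ pB then
            nReTr (X x κ * (η₀ x * (η (x + e κ) - η x) - (η (x + e κ) - η x) * η₀ x)) else 0)
        - (1 / 2) * ∑ x ∈ pB, ∑ κ : Fin d, (if x + e κ ∈ pB then
            nReTr (X x κ * (mbar * (η (x + e κ) - η x) - (η (x + e κ) - η x) * mbar)) else 0) := by
    rw [hD, Finset.mul_sum, Finset.mul_sum, ← Finset.sum_sub_distrib, ← Finset.sum_sub_distrib, ← Finset.sum_sub_distrib]
    refine Finset.sum_congr rfl fun x hx => ?_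
    rw [Finset.mul_sum, Finset.mul_sum, ← Finset.sum_sub_distrib, ← Finset.sum_sub_distrib, ← Finset.sum_sub_distrib]
    refine Finset.sum_congr rfl fun κ _ => ?_
    by_cases hxκ : x + e κ ∈ pB
    · simp only [hxκ, if_true]; rw [hbond x κ hx hxκ]; try ring
    · simp only [hxκ, if_false]; ring
  -- §c the `(L − 1)δ²` term
  have hc : |∑ x ∈ pB, ∑ κ : Fin d, (if x + e κ ∈ pB then nReTr ((L x κ - 1) * ((η (x + e κ) - η x) * (η (x + e κ) - η x))) else 0)|
      ≤ N * w * D := by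
    rw [hD, Finset.mul_sum]
    refine (Finset.abs_sum_le_sum_abs _ _).trans (Finset.sum_le_sum fun x hx => ?_)
    rw [Finset.mul_sum]
    refine (Finset.abs_sum_le_sum_abs _ _).trans (Finset.sum_le_sum fun κ _ => ?_)
    by_cases hxκ : x + e κ ∈ pB
    · simp only [hxκ, if_true]
      calc |nReTr ((L x κ - 1) * ((η (x + e κ) - η x) * (η (x + e κ) - η x)))|
          ≤ ‖L x κ - 1‖ * ‖(η (x + e κ) - η x) * (η (x + e κ) - η x)‖ := abs_nReTr_mul_le _ _
        _ ≤ w * ‖η (x + e κ) - η x‖ ^ 2 := by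
            rw [sq]; exact mul_le_mul (hw x κ hx hxκ) (norm_mul_le _ _) (norm_nonneg _) hw0
        _ ≤ w * (N * nhsNormSq (η (x + e κ) - η x)) := mul_le_mul_of_nonneg_left (norm_sq_le_card_mul_nhsNormSq _) hw0
        _ = N * w * nhsNormSq (η (x + e κ) - η x) := by ring
    · simp only [hxκ, if_false, abs_zero, mul_zero]; exact le_rfl
  -- §d the mean-zero commutator term: AM–GM and the box Poincaré inequality
  have hpoinc : ∑ x ∈ pB, nhsNormSq (η₀ x) ≤ (m : ℝ) * (m + 1) / 2 * D := poincare_periodBox_nhs m η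
  have hd' : |∑ x ∈ pB, ∑ κ : Fin d, (if x + e κ ∈ pB then
      nReTr (X x κ * (η₀ x * (η (x + e κ) - η x) - (η (x + e κ) - η x) * η₀ x)) else 0)| ≤ 2 * (N * d * (m + 1) * wa) * D := by
    -- termwise: `|Re tr(X[η₀,δ])∕n| ≤ 2 wa ‖η₀‖‖δ‖ ≤ wa (λ‖η₀‖² + λ⁻¹‖δ‖²)`, `λ = 1/(m+1)`
    have hm1 : (0 : ℝ) < (m : ℝ) + 1 := by positivity
    have hterm : ∀ (x : Site d) (κ : Fin d), x ∈ pB → x + e κ ∈ pB →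
        |nReTr (X x κ * (η₀ x * (η (x + e κ) - η x) - (η (x + e κ) - η x) * η₀ x))|
          ≤ wa * ((1 / ((m : ℝ) + 1)) * (N * nhsNormSq (η₀ x)) + ((m : ℝ) + 1) * (N * nhsNormSq (η (x + e κ) - η x))) := by
      intro x κ hx hxκ
      have h1 : |nReTr (X x κ * (η₀ x * (η (x + e κ) - η x) - (η (x + e κ) - η x) * η₀ x))|
          ≤ wa * (2 * (‖η₀ x‖ * ‖η (x + e κ) - η x‖)) := by
        calc _ ≤ ‖X x κ‖ * ‖η₀ x * (η (x + e κ) - η x) - (η (x + e κ) - η x) * η₀ x‖ := abs_nReTr_mul_le _ _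
          _ ≤ wa * (2 * (‖η₀ x‖ * ‖η (x + e κ) - η x‖)) := by
              refine mul_le_mul (hwa x κ hx hxκ) ?_ (norm_nonneg _) hwa0
              calc _ ≤ ‖η₀ x * (η (x + e κ) - η x)‖ + ‖(η (x + e κ) - η x) * η₀ x‖ := norm_sub_le _ _
                _ ≤ ‖η₀ x‖ * ‖η (x + e κ) - η x‖ + ‖η (x + e κ) - η x‖ * ‖η₀ x‖ := add_le_add (norm_mul_le _ _) (norm_mul_le _ _)
                _ = 2 * (‖η₀ x‖ * ‖η (x + e κ) - η x‖) := by ring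
      have h2 : 2 * (‖η₀ x‖ * ‖η (x + e κ) - η x‖)
          ≤ (1 / ((m : ℝ) + 1)) * ‖η₀ x‖ ^ 2 + ((m : ℝ) + 1) * ‖η (x + e κ) - η x‖ ^ 2 := by
        have hsq : 0 ≤ ((1 / ((m : ℝ) + 1)) * ‖η₀ x‖ - ‖η (x + e κ) - η x‖) ^ 2 := sq_nonneg _
        have hid : (1 / ((m : ℝ) + 1)) * ‖η₀ x‖ ^ 2 + ((m : ℝ) + 1) * ‖η (x + e κ) - η x‖ ^ 2 - 2 * (‖η₀ x‖ * ‖η (x + e κ) - η x‖)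
            = ((m : ℝ) + 1) * ((1 / ((m : ℝ) + 1)) * ‖η₀ x‖ - ‖η (x + e κ) - η x‖) ^ 2 := by
          field_simp; ring
        nlinarith
      have h3 : ‖η₀ x‖ ^ 2 ≤ N * nhsNormSq (η₀ x) := norm_sq_le_card_mul_nhsNormSq _
      have h4 : ‖η (x + e κ) - η x‖ ^ 2 ≤ N * nhsNormSq (η (x + e κ) - η x) := norm_sq_le_card_mul_nhsNormSq _
      have h5 : (1 / ((m : ℝ) + 1)) * ‖η₀ x‖ ^ 2 ≤ (1 / ((m : ℝ) + 1)) * (N * nhsNormSq (η₀ x)) :=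
        mul_le_mul_of_nonneg_left h3 (by positivity)
      have h6 : ((m : ℝ) + 1) * ‖η (x + e κ) - η x‖ ^ 2 ≤ ((m : ℝ) + 1) * (N * nhsNormSq (η (x + e κ) - η x)) :=
        mul_le_mul_of_nonneg_left h4 hm1.le
      calc _ ≤ wa * (2 * (‖η₀ x‖ * ‖η (x + e κ) - η x‖)) := h1
        _ ≤ wa * ((1 / ((m : ℝ) + 1)) * (N * nhsNormSq (η₀ x)) + ((m : ℝ) + 1) * (N * nhsNormSq (η (x + e κ) - η x))) :=
            mul_le_mul_of_nonneg_left (by linarith) hwa0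
    -- sum the termwise bound
    have hS : |∑ x ∈ pB, ∑ κ : Fin d, (if x + e κ ∈ pB then
        nReTr (X x κ * (η₀ x * (η (x + e κ) - η x) - (η (x + e κ) - η x) * η₀ x)) else 0)|
        ≤ ∑ x ∈ pB, ∑ κ : Fin d, wa * ((1 / ((m : ℝ) + 1)) * (N * nhsNormSq (η₀ x))
            + ((m : ℝ) + 1) * (if x + e κ ∈ pB then N * nhsNormSq (η (x + e κ) - η x) else 0)) := by
      refine (Finset.abs_sum_le_sum_abs _ _).trans (Finset.sum_le_sum fun x hx => ?_)
      refine (Finset.abs_sum_le_sum_abs _ _).trans (Finset.sum_le_sum fun κ _ => ?_)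
      by_cases hxκ : x + e κ ∈ pB
      · simp only [hxκ, if_true]; exact hterm x κ hx hxκ
      · simp only [hxκ, if_false, abs_zero, mul_zero, add_zero]
        exact mul_nonneg hwa0 (mul_nonneg (by positivity) (mul_nonneg hN0.le (MatrixNorms.nhsNormSq_nonneg _)))
    -- evaluate the majorant
    have hmaj : ∑ x ∈ pB, ∑ κ : Fin d, wa * ((1 / ((m : ℝ) + 1)) * (N * nhsNormSq (η₀ x))
            + ((m : ℝ) + 1) * (if x + e κ ∈ pB then N * nhsNormSq (η (x + e κ) - η x) else 0))
        = wa * ((1 / ((m : ℝ) + 1)) * N * ((d : ℝ) * ∑ x ∈ pB, nhsNormSq (η₀ x)) + ((m : ℝ) + 1) * N * D) := by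
      rw [hD]
      simp only [Finset.mul_sum, Finset.sum_add_distrib, mul_add]
      congr 1
      · refine Finset.sum_congr rfl fun x _ => ?_
        rw [Finset.sum_const, Finset.card_univ, Fintype.card_fin, nsmul_eq_mul]; ring
      · refine Finset.sum_congr rfl fun x _ => Finset.sum_congr rfl fun κ _ => ?_
        split_ifs <;> ring
    have hfin : wa * ((1 / ((m : ℝ) + 1)) * N * ((d : ℝ) * ∑ x ∈ pB, nhsNormSq (η₀ x)) + ((m : ℝ) + 1) * N * D)
        ≤ 2 * (N * d * (m + 1) * wa) * D := by
      have hd1 : (1 : ℝ) ≤ d := by exact_mod_cast hd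
      have h1 : (1 / ((m : ℝ) + 1)) * N * ((d : ℝ) * ∑ x ∈ pB, nhsNormSq (η₀ x))
          ≤ (1 / ((m : ℝ) + 1)) * N * ((d : ℝ) * ((m : ℝ) * (m + 1) / 2 * D)) :=
        mul_le_mul_of_nonneg_left (mul_le_mul_of_nonneg_left hpoinc (by positivity)) (by positivity)
      have h2 : (1 / ((m : ℝ) + 1)) * N * ((d : ℝ) * ((m : ℝ) * (m + 1) / 2 * D)) = N * d * m / 2 * D := by
        field_simp
      have hm0 : (0 : ℝ) ≤ m := Nat.cast_nonneg m
      have h3 : N * d * m / 2 * D + ((m : ℝ) + 1) * N * D ≤ 2 * (N * d * (m + 1)) * D := by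
        have hk : 0 ≤ (d : ℝ) * (3 * m / 2 + 2) - (m + 1) := by nlinarith
        have hid : 2 * (N * d * (m + 1)) * D - (N * d * m / 2 * D + ((m : ℝ) + 1) * N * D)
            = N * D * ((d : ℝ) * (3 * m / 2 + 2) - (m + 1)) := by ring
        nlinarith [mul_nonneg (mul_nonneg hN0.le hD0) hk]
      calc _ ≤ wa * (N * d * m / 2 * D + ((m : ℝ) + 1) * N * D) := by
            refine mul_le_mul_of_nonneg_left ?_ hwa0; rw [← h2]; linarith
        _ ≤ wa * (2 * (N * d * (m + 1)) * D) := mul_le_mul_of_nonneg_left h3 hwa0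
        _ = 2 * (N * d * (m + 1) * wa) * D := by ring
    exact hS.trans (hmaj ▸ hfin)
  -- §e the mean commutator term: integration by parts
  have hlinsum : ∀ (s : Finset (Site d)) (f : Site d → Matrix n n ℂ), nReTr (∑ x ∈ s, f x) = ∑ x ∈ s, nReTr (f x) := fun s f => by
    have h := map_sum (T4AveragingDeficitWall.nReTrL (n := n)) f s
    simpa only [T4AveragingDeficitWall.nReTrL_apply] using h
  have hlinsumκ : ∀ f : Fin d → Matrix n n ℂ, nReTr (∑ κ, f κ) = ∑ κ, nReTr (f κ) := fun f => by
    have h := map_sum (T4AveragingDeficitWall.nReTrL (n := n)) f Finset.univ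
    simpa only [T4AveragingDeficitWall.nReTrL_apply] using h
  have hF : ∀ x : Site d, ∑ κ : Fin d, ((if x - e κ ∈ pB then X (x - e κ) κ else 0) - (if x + e κ ∈ pB then X x κ else 0)) = -E x := by
    intro x; simp only [hE, ← Finset.sum_neg_distrib, neg_sub]
  have he : ∑ x ∈ pB, ∑ κ : Fin d, (if x + e κ ∈ pB then
        nReTr (X x κ * (mbar * (η (x + e κ) - η x) - (η (x + e κ) - η x) * mbar)) else 0)
      = -∑ x ∈ pB, nReTr ((η x * E x - E x * η x) * mbar) := by
    -- cyclicity: `Re tr(X(mδ − δm)) = Re tr((δX − Xδ)m)`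
    have hcyc : ∀ (x : Site d) (κ : Fin d), nReTr (X x κ * (mbar * (η (x + e κ) - η x) - (η (x + e κ) - η x) * mbar))
        = nReTr ((((η (x + e κ) * X x κ - X x κ * η (x + e κ)) - (η x * X x κ - X x κ * η x))) * mbar) := by
      intro x κ
      rw [mul_sub, nReTr_sub, ← mul_assoc (X x κ) mbar, nReTr_mul_comm (X x κ * mbar) (η (x + e κ) - η x), ← nReTr_sub]
      congr 1; noncomm_ring
    have hite : ∀ (x : Site d) (κ : Fin d), (if x + e κ ∈ pB then
          nReTr ((((η (x + e κ) * X x κ - X x κ * η (x + e κ)) - (η x * X x κ - X x κ * η x))) * mbar) else 0)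
        = nReTr ((if x + e κ ∈ pB then ((η (x + e κ) * X x κ - X x κ * η (x + e κ)) - (η x * X x κ - X x κ * η x)) else 0) * mbar) := by
      intro x κ
      split_ifs
      · rfl
      · rw [zero_mul]; simp [nReTr]
    calc ∑ x ∈ pB, ∑ κ : Fin d, (if x + e κ ∈ pB then
            nReTr (X x κ * (mbar * (η (x + e κ) - η x) - (η (x + e κ) - η x) * mbar)) else 0)
        = ∑ x ∈ pB, ∑ κ : Fin d, nReTr ((if x + e κ ∈ pB then
            ((η (x + e κ) * X x κ - X x κ * η (x + e κ)) - (η x * X x κ - X x κ * η x)) else 0) * mbar) := by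
          simp only [hcyc, hite]
      _ = nReTr ((∑ x ∈ pB, ∑ κ : Fin d, (if x + e κ ∈ pB then
            ((η (x + e κ) * X x κ - X x κ * η (x + e κ)) - (η x * X x κ - X x κ * η x)) else 0)) * mbar) := by
          rw [Finset.sum_mul, hlinsum]
          refine Finset.sum_congr rfl fun x _ => ?_
          rw [Finset.sum_mul, hlinsumκ]
      _ = nReTr ((∑ x ∈ pB, (η x * (∑ κ : Fin d, ((if x - e κ ∈ pB then X (x - e κ) κ else 0)
              - (if x + e κ ∈ pB then X x κ else 0)))
            - (∑ κ : Fin d, ((if x - e κ ∈ pB then X (x - e κ) κ else 0)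
              - (if x + e κ ∈ pB then X x κ else 0))) * η x)) * mbar) := by
          rw [sum_bond_comm_resum (m + 1) η X]
      _ = -∑ x ∈ pB, nReTr ((η x * E x - E x * η x) * mbar) := by
          rw [Finset.sum_mul, hlinsum, ← Finset.sum_neg_distrib]
          refine Finset.sum_congr rfl fun x _ => ?_
          rw [hF x, ← nReTr_neg']
          congr 1; noncomm_ring
  have he' : |∑ x ∈ pB, ∑ κ : Fin d, (if x + e κ ∈ pB then
      nReTr (X x κ * (mbar * (η (x + e κ) - η x) - (η (x + e κ) - η x) * mbar)) else 0)| ≤ 2 * (‖mbar‖ * ∑ x ∈ pB, ‖η x‖ * ‖E x‖) := by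
    rw [he, abs_neg, Finset.mul_sum, Finset.mul_sum]
    refine (Finset.abs_sum_le_sum_abs _ _).trans (Finset.sum_le_sum fun x _ => ?_)
    calc |nReTr ((η x * E x - E x * η x) * mbar)| ≤ ‖η x * E x - E x * η x‖ * ‖mbar‖ := abs_nReTr_mul_le _ _
      _ ≤ (‖η x‖ * ‖E x‖ + ‖E x‖ * ‖η x‖) * ‖mbar‖ :=
          mul_le_mul_of_nonneg_right ((norm_sub_le _ _).trans (add_le_add (norm_mul_le _ _) (norm_mul_le _ _))) (norm_nonneg _)
      _ = 2 * (‖mbar‖ * (‖η x‖ * ‖E x‖)) := by ring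
  -- §f assemble
  rw [hsum]
  have h1 := (abs_le.1 hc).2
  have h2 := (abs_le.1 hd').2
  have h3 := (abs_le.1 he').2
  nlinarith [hD0, hN0]

end

end Summit.QuantumFields.BalabanUV.T4Continuum.NE7TraceLinkHessianLower
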